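/-
Copyright (c) 2026 the pub-hodgecm-mathlib formalisation cell (harness21).  Prover seat hodgecm-mathlib-K2Liu-p01 (g10), Track B «K2-LIT»,
#184♮ = hLiu418 = `stmt-HodgeConjecture-24832`; #42S organ S1 ROAD W, (G) organ ROW (ρ-mid), step (C2c) of K2Liu-p26 (g0)'s (M2a) HANDOFF 2026-09-04T16:50:16Z
(K2Liu-p01 (g10) lead of the remaining (M2a) chain, LEAD F0P6-plan (g14) BATCH #58 (7)(vii)): THE CAYLEY LETTER OF THE FRAME-TRANSPORTED BLOCK IMPLEMENTER
`E′ := π(frameMp_{PD} j̃(p₁, p₂))` (its big-cell profile row `hprof` in ★ (δ5)'s binder bytes is the sequel `K2LiuWitnessImplementerProfile`).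
-/
import Summits.HodgeConjecture.HodgeConjecture.Theorems.K2LiuTensorMiddleCellHaarDelta        -- ★ (C2a∕C2b′): the tensor∕block frame, `boxLoc` at the tensor datum (⇒ ★ F4a, ★ F4b, ★ F6a)
import Summits.HodgeConjecture.HodgeConjecture.Theorems.K2LiuBlockSumWeylDelta               -- ★ [W1] `iotaD_weylDelta_finSum`
import Summits.HodgeConjecture.HodgeConjecture.Theorems.K2LiuTensorFrameWeylDelta            -- ★ [W2] `frameSp_iota_weylDelta`
import Summits.HodgeConjecture.HodgeConjecture.Theorems.K2LiuSymplecticBlockLeviTransport    -- ★ [W3] `spInl_mul_spInr_cayleyLetter`, ★ [W4] `frameSp_transportSp_symJ_inv_mul_levi`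
import HarnessLib

/-!
# Crux `HLiu418`, #42S-S1 ROAD W, (G) organ ROW (ρ-mid), step (C2c) part 1: THE WITNESS IMPLEMENTER `(E′, Γ) := (π, op)(frameMp_{PD} j̃(p₁, p₂))` IS A
# CAYLEY-TYPE MOVER-IMPLEMENTER

Cell `hodgecm-mathlib`, crux item hLiu418 = `stmt-HodgeConjecture-24832` (helper lane `--supports … --as helper`, count-neutral).  THEOREMS ONLY (no `def`, no
instance, no notation, no named-fact hypothesis, no `sorry`).  Currency of ★ (M1) ∕ ★ (C2a) `K2LiuTensorMiddleCellHaarDelta` verbatim: the CM tensor datum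
`Σ_{𝕍⊗V′}` (`n′ = M₂ + M₂`, Gram matrix `T₀ = gramR e′ dV (tensorFrame dW eW dV′)`), the permutation frame `P` (`hPσ`, `hP : Pᵀ T₀ P = T₁ ⊕ᶠ T₂`), `PD = P ⊕ P`
(`hPD`), the block data `T₁, T₂` (`hT₁ hT₂`, local Gram units `hTv₁ hTv₂ hTv′`), two CAYLEY-TYPE block implementers `p₁, p₂` (`hW₁ hW₂` in ★ F4a's shape: `π(p_j) ι_j(w_Δ) π(p_j)⁻¹
= (tS_j J)⁻¹ · tS_j(m(B_j))`).

WHY.  The (G)-inert organ builds the lattice-pair witness `Φ_ε` by ★ (δ5) `K2LiuInertWitnessPackageOfMoverGeneral.exists_inert_witness_reading_of_mover_general` on ANY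
mover-implementer `(E′, Γ)` supplied WITH its big-cell profile row `hprof` by value.  For the middle-profile row (M2a) the organ CHOOSES `(E′_ε, Γ_ε) := (π, op)(frameMp_{PD} j̃(p₁, p₂))`
(★ (C2b′): then `op(j̃)(frameOp⁻¹ Φ_ε) = frameOp⁻¹(Γ_ε Φ_ε)` on the nose).  THIS FILE supplies two of the three by-value inputs (δ5) asks of that choice (the third, `hprof`, is the sequel):
* §1 **`exists_proj_frameMp_boxLoc_conj_iotaD_weylDelta`** — THE CAYLEY LETTER: `∃ B′, E′_ε · ι(w_Δ) · E′_ε⁻¹ = (tS J)⁻¹ · tS(m(B′))` in `Sp(𝕎^𝔻_{T₀})` (the proof's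
  letter is `B′ = P̂D (B₁ ⊞_{blkIdx} B₂) P̂D⁻¹`; ★ F4a consumes ANY `B′`).  Proof:
  `π ∘ frameMp = frameSp ∘ π` (★ `proj_frameMp`), ★ [W2] `ι(w_Δ) = frameSp_{PD}(ι′(w_Δ′))`, ★ `proj_boxLoc` `π(j̃) = spInl π(p₁) · spInr π(p₂)`, ★ [W1]
  `ι′(w_Δ′) = spInl ι₁(w_Δ) · spInr ι₂(w_Δ)`, the commuting summands (§0 `spInl_mul_spInr_conj`), `hW₁`, `hW₂`, ★ [W3] `spInl_mul_spInr_cayleyLetter`, and ★ [W4]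
  `frameSp_transportSp_symJ_inv_mul_levi` for the ORTHOGONAL frame `PD PDᵀ = 1` (§0 `pd_mul_transpose_pd`, `P` a permutation matrix).
* §2 **`map_deltaLagrangian_proj_frameMp_boxLoc`** — `E′_ε` is a MOVER (`E′_ε ℓ_Δ = ℓ_Y`): ★ `map_proj_frameMp_pd_deltaLagrangian` ∘ ★ F6a `map_deltaLagrangian_proj_boxLoc`.
SEQUEL (`K2LiuWitnessImplementerProfile`, same seat): §3 ★ F4b's profile row WITH the implementer as a binder (ANY Cayley-type `(E′, Γ, B′)`, generic `n′`) and
§4 the profile row `hprof` of `(E′_ε, Γ_ε)` in ★ (δ5)'s binder bytes (§3 at §1 + §2, `hΓ` = ★ `MpPsi.toRep_implements`).  USE ((C3), then ★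
`K2LiuLocalSWSpanningInertOfPackages`): feed ★ (δ5) with `E′ := π(frameMp_{PD} j̃)`, `hE′ := §2`, `Γ := op(frameMp_{PD} j̃)`, `hΓ := MpPsi.toRep_implements _ _`, `hprof :=`
the sequel's §4; the witness' middle row is then ★ (C2b′) read through `Γ_ε Φ_ε = 𝟙_{κ⁻¹B₁} − 𝟙_{κ⁻¹B₂}`.
References: [Kudla1994] §2–§3, Thm. 3.1; [Kudla1984] §1; [MoeglinVignerasWaldspurger1987] Chap. 2 II.1 Rem. (3), (6), II.2, II.6; [Rangarao1993] §3.1 (3.9), Lemma 3.2;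
[Weil1964] n° 13, n° 32, n° 34; [HarrisKudlaSweet1996] §1 (1.11), (1.15)–(1.16); [KudlaRallis1994] §1.
HONEST LABEL.  Count-neutral helper; `HC_CM` is proved only modulo the 7 printed citations (2 remaining named inputs: hLiu418 = `stmt-HodgeConjecture-24832`,
h413 = `stmt-HodgeConjecture-24833`) until rung 0 closes.  NOT here: the profile row (sequel), (C3) (the Levi step and the κ-reading of the middle row), `hfac±`.

## References
* [Kudla1994] S. S. Kudla, *Splitting metaplectic covers of dual reductive pairs*, Israel J. Math. 87 (1994), §2–§3, Thm. 3.1.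
* [Kudla1984] S. S. Kudla, *Seesaw dual reductive pairs*, Progr. Math. 46 (1984), §1.
* [MoeglinVignerasWaldspurger1987] C. Mœglin, M.-F. Vignéras, J.-L. Waldspurger, LNM 1291 (1987), Chap. 2 II.
* [Rangarao1993] R. Ranga Rao, Pacific J. Math. 157 (1993), §3.1, Lemma 3.2.
* [Weil1964] A. Weil, Acta Math. 111 (1964), n° 13, n° 32, n° 34.
* [HarrisKudlaSweet1996] M. Harris, S. Kudla, W. J. Sweet, J. Amer. Math. Soc. 9 (1996), §1.
* [KudlaRallis1994] S. Kudla, S. Rallis, Ann. of Math. 140 (1994), §1.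
-/

set_option autoImplicit false
set_option linter.dupNamespace false -- the mandated namespace repeats `HodgeConjecture.HodgeConjecture`

noncomputable section

open scoped Matrix Kronecker
open NumberField IsDedekindDomain MeasureTheory MeasureTheory.Measure Matrix
open Literature.RepresentationTheory.HeisenbergGroup Literature.RepresentationTheory.HeisenbergGroup.SymplecticMatrix
open Literature.NumberTheory.Automorphic Literature.NumberTheory.Automorphic.UnitaryGroup Literature.NumberTheory.Weil1964
open Literature.NumberTheory.GaloisRepresentations Literature.NumberTheory.GaloisRepresentations.IsNonarchimedeanLocalField
open Literature.RepresentationTheory.HarrisKudlaSweet1996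
open Literature.NumberTheory.GelbartRogawski1991 Literature.NumberTheory.GelbartRogawski1991.GRConstruction
open Literature.NumberTheory.GelbartRogawski1991.AdaptedBlocks
open Literature.NumberTheory.GelbartRogawski1991.UnitaryDualPair
open Literature.NumberTheory.GelbartRogawski1991.UnitaryDualPair.LocalSplitting
open Literature.NumberTheory.GelbartRogawski1991.UnitaryDualPair.LocalSplitting.FrameTransport
open Literature.NumberTheory.GelbartRogawski1991.UnitaryDualPair.LocalSplitting.DoubledBlock
open Literature.NumberTheory.K2Lit.SiegelDoubled
open Summit.HodgeConjecture.HodgeConjecture.Cruxes.HLiu418.K2LiuLocalSWSectionDefs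
open Summit.HodgeConjecture.HodgeConjecture.Cruxes.HLiu418.K2LiuLocalSWTensorAdaptedBlocks
open Summit.HodgeConjecture.HodgeConjecture.Cruxes.HLiu418.K2LiuLocalSWBigCellWords
open Summit.HodgeConjecture.HodgeConjecture.Cruxes.HLiu418.K2LiuLocalSWBigCellFormula
open Summit.HodgeConjecture.HodgeConjecture.Cruxes.HLiu418.K2LiuLocalSWTensorBigCellLetters
open Summit.HodgeConjecture.HodgeConjecture.Cruxes.HLiu418.K2LiuLocalSWMiddleCellFunctional
open Summit.HodgeConjecture.HodgeConjecture.Cruxes.HLiu418.K2LiuBlockSumWeylDelta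
open Summit.HodgeConjecture.HodgeConjecture.Cruxes.HLiu418.K2LiuTensorFrameWeylDelta
open Summit.HodgeConjecture.HodgeConjecture.Cruxes.HLiu418.K2LiuSymplecticBlockLeviTransport

namespace Summit.HodgeConjecture.HodgeConjecture.Cruxes.HLiu418.K2LiuWitnessImplementerCayley

/-! ## §0 Two bookkeeping lemmas: conjugation by a block pair; the doubled permutation frame is orthogonal -/

section Blocks

variable {K : Type*} [CommRing K] {ι₁ ι₂ ι : Type*} [Fintype ι₁] [Fintype ι₂] [Fintype ι] [DecidableEq ι₁] [DecidableEq ι₂] [DecidableEq ι]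
  (eι : ι₁ ⊕ ι₂ ≃ ι) (S₁ : Matrix ι₁ ι₁ K) (S₂ : Matrix ι₂ ι₂ K) {S : Matrix ι ι K} (hS : S = Matrix.reindex eι eι (Matrix.fromBlocks S₁ 0 0 S₂))

/-- **conjugation by a block pair is blockwise**: `(a ⊕ b)(x ⊕ y)(a ⊕ b)⁻¹ = (a x a⁻¹) ⊕ (b y b⁻¹)` in `Sp(𝕎₁ ⊕ 𝕎₂)` (the two embedded summands commute,
★ `spInl_mul_spInr_comm`). [cite: Kudla1984, §1] [cite: MoeglinVignerasWaldspurger1987, Chap. 2 II.1 Rem. (6)] -/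
theorem spInl_mul_spInr_conj (a x : symplecticGroup (polar (Matrix.toLinearMap₂' K S₁))) (b y : symplecticGroup (polar (Matrix.toLinearMap₂' K S₂))) :
    spInl eι S₁ S₂ hS a * spInr eι S₁ S₂ hS b * (spInl eι S₁ S₂ hS x * spInr eι S₁ S₂ hS y) * (spInl eι S₁ S₂ hS a * spInr eι S₁ S₂ hS b)⁻¹ =
      spInl eι S₁ S₂ hS (a * x * a⁻¹) * spInr eι S₁ S₂ hS (b * y * b⁻¹) := by
  have h1 : spInr eι S₁ S₂ hS b * spInl eι S₁ S₂ hS x = spInl eι S₁ S₂ hS x * spInr eι S₁ S₂ hS b := (spInl_mul_spInr_comm eι S₁ S₂ hS x b).symm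
  have h2 : spInr eι S₁ S₂ hS b * spInr eι S₁ S₂ hS y * (spInr eι S₁ S₂ hS b)⁻¹ * (spInl eι S₁ S₂ hS a)⁻¹ =
      (spInl eι S₁ S₂ hS a)⁻¹ * (spInr eι S₁ S₂ hS b * spInr eι S₁ S₂ hS y * (spInr eι S₁ S₂ hS b)⁻¹) := by
    rw [← map_inv (spInr eι S₁ S₂ hS) b, ← map_inv (spInl eι S₁ S₂ hS) a, ← map_mul (spInr eι S₁ S₂ hS) b y,
      ← map_mul (spInr eι S₁ S₂ hS) (b * y) b⁻¹]
    exact (spInl_mul_spInr_comm eι S₁ S₂ hS a⁻¹ (b * y * b⁻¹)).symm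
  simp only [map_mul, map_inv]
  rw [_root_.mul_inv_rev]
  calc spInl eι S₁ S₂ hS a * spInr eι S₁ S₂ hS b * (spInl eι S₁ S₂ hS x * spInr eι S₁ S₂ hS y) * ((spInr eι S₁ S₂ hS b)⁻¹ * (spInl eι S₁ S₂ hS a)⁻¹)
      = spInl eι S₁ S₂ hS a * (spInr eι S₁ S₂ hS b * spInl eι S₁ S₂ hS x) * spInr eι S₁ S₂ hS y * (spInr eι S₁ S₂ hS b)⁻¹ * (spInl eι S₁ S₂ hS a)⁻¹ := by
        simp only [mul_assoc]
    _ = spInl eι S₁ S₂ hS a * spInl eι S₁ S₂ hS x * (spInr eι S₁ S₂ hS b * spInr eι S₁ S₂ hS y * (spInr eι S₁ S₂ hS b)⁻¹ * (spInl eι S₁ S₂ hS a)⁻¹) := by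
        rw [h1]; simp only [mul_assoc]
    _ = spInl eι S₁ S₂ hS a * spInl eι S₁ S₂ hS x * (spInl eι S₁ S₂ hS a)⁻¹ * (spInr eι S₁ S₂ hS b * spInr eι S₁ S₂ hS y * (spInr eι S₁ S₂ hS b)⁻¹) := by
        rw [h2]; simp only [mul_assoc]

end Blocks

/-- **the doubled permutation frame is ORTHOGONAL**: `P = σ.toPEquiv.toMatrix`, `PD = P ⊕ P` ⇒ `PD · PDᵀ = 1` (`P Pᵀ = 1` for a permutation matrix).
[cite: Weil1964, n° 34] [cite: Kudla1994, §2] -/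
theorem pd_mul_transpose_pd {F : Type} [Field F] (n : ℕ) {σ : Equiv.Perm (Fin n)} (P : GL (Fin n) F)
    (hPσ : (P : Matrix (Fin n) (Fin n) F) = σ.toPEquiv.toMatrix)
    {PD : GL (Fin (n + n)) F} (hPD : PD = UnitaryGroup.reindexGL (e₂ n) (UnitaryGroup.blockDiagGL (P, P))) :
    (PD : Matrix (Fin (n + n)) (Fin (n + n)) F) * ((PD : Matrix (Fin (n + n)) (Fin (n + n)) F))ᵀ = 1 := by
  have hPP : (P : Matrix (Fin n) (Fin n) F) * ((P : Matrix (Fin n) (Fin n) F))ᵀ = 1 := by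
    rw [hPσ, ← PEquiv.toMatrix_symm, ← Equiv.toPEquiv_symm, ← PEquiv.toMatrix_trans, ← Equiv.toPEquiv_trans, Equiv.self_trans_symm,
      Equiv.toPEquiv_refl, PEquiv.toMatrix_refl]
  subst hPD
  rw [UnitaryGroup.coe_reindexGL, UnitaryGroup.coe_blockDiagGL, Matrix.transpose_reindex, Matrix.reindex_apply, Matrix.reindex_apply,
    Matrix.submatrix_mul_equiv, Matrix.fromBlocks_transpose, Matrix.fromBlocks_multiply]
  simp only [Matrix.transpose_zero, Matrix.mul_zero, Matrix.zero_mul, add_zero, zero_add, hPP, Matrix.fromBlocks_one, Matrix.submatrix_one_equiv]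

/-! ## §1 The Cayley letter of `E′ := π(frameMp_{PD} j̃(p₁, p₂))` at the tensor datum -/

variable (L : Type) [Field L] [NumberField L] [IsCMField L]
variable {N M : ℕ} (e : Fin N × Fin M ≃ Fin 2)
  (dV : Fin N → L) (hdV : ∀ i, IsCMField.complexConj L (dV i) = dV i)
  (dW : Fin M → L) (hdW : ∀ i, IsCMField.complexConj L (dW i) = dW i)
variable {M₂ M' : ℕ} (eW : Fin M × Fin M₂ ≃ Fin M') (e' : Fin N × Fin M' ≃ Fin (M₂ + M₂))
  (dV' : Fin M₂ → L) (hdV' : ∀ k, IsCMField.complexConj L (dV' k) = dV' k)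
  (v : HeightOneSpectrum (𝓞 (Fp L)))

section CayleyLetter

variable {σ : Equiv.Perm (Fin (M₂ + M₂))} {T₁ T₂ : Matrix (Fin M₂) (Fin M₂) (Fp L)}
  (P : GL (Fin (M₂ + M₂)) (Fp L)) (hPσ : (P : Matrix (Fin (M₂ + M₂)) (Fin (M₂ + M₂)) (Fp L)) = σ.toPEquiv.toMatrix)
  (hP : ((P : Matrix (Fin (M₂ + M₂)) (Fin (M₂ + M₂)) (Fp L)))ᵀ *
      gramR L e' dV hdV (tensorFrame L dW eW dV') (tensorFrame_real L dW hdW eW dV' hdV') * (P : Matrix _ _ (Fp L)) =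
    UnitaryGroup.finSum M₂ M₂ T₁ T₂)
  {PD : GL (Fin ((M₂ + M₂) + (M₂ + M₂))) (Fp L)} (hPD : PD = UnitaryGroup.reindexGL (e₂ (M₂ + M₂)) (UnitaryGroup.blockDiagGL (P, P)))
  (hT₁ : T₁.IsSymm) (hT₂ : T₂.IsSymm)
  (hTv : IsUnit (localGram (Fp L) ((M₂ + M₂) + (M₂ + M₂))
    (gramD (Fp L) (M₂ + M₂) (gramR L e' dV hdV (tensorFrame L dW eW dV') (tensorFrame_real L dW hdW eW dV' hdV'))) v).det)
  (hTv' : IsUnit (localGram (Fp L) ((M₂ + M₂) + (M₂ + M₂)) (gramD (Fp L) (M₂ + M₂) (UnitaryGroup.finSum M₂ M₂ T₁ T₂)) v).det)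
  (hTv₁ : IsUnit (localGram (Fp L) (M₂ + M₂) (gramD (Fp L) M₂ T₁) v).det)
  (hTv₂ : IsUnit (localGram (Fp L) (M₂ + M₂) (gramD (Fp L) M₂ T₂) v).det)
  (p₁ : LocalMp (Fp L) (M₂ + M₂) (gramD (Fp L) M₂ T₁) v) (B₁ : GL (Fin (M₂ + M₂)) (v.adicCompletion (Fp L)))
  (hW₁ : MpPsi.proj _ p₁ * iotaD (Fp L) L (IsCMField.complexConj L) (complexConj_imagUnit L) (imagUnit_ne_zero L)
      (imagUnit_mul_self L) v M₂ hT₁ rfl (weylDelta (Fp L) L (IsCMField.complexConj L) v M₂ (T₀ := T₁) rfl) * (MpPsi.proj _ p₁)⁻¹ =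
    (transportSp (localGram (Fp L) (M₂ + M₂) (gramD (Fp L) M₂ T₁) v) hTv₁ (SymplecticGroup.symJ _ _))⁻¹ *
      transportSp (localGram (Fp L) (M₂ + M₂) (gramD (Fp L) M₂ T₁) v) hTv₁ (levi B₁))
  (p₂ : LocalMp (Fp L) (M₂ + M₂) (gramD (Fp L) M₂ T₂) v) (B₂ : GL (Fin (M₂ + M₂)) (v.adicCompletion (Fp L)))
  (hW₂ : MpPsi.proj _ p₂ * iotaD (Fp L) L (IsCMField.complexConj L) (complexConj_imagUnit L) (imagUnit_ne_zero L)
      (imagUnit_mul_self L) v M₂ hT₂ rfl (weylDelta (Fp L) L (IsCMField.complexConj L) v M₂ (T₀ := T₂) rfl) * (MpPsi.proj _ p₂)⁻¹ =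
    (transportSp (localGram (Fp L) (M₂ + M₂) (gramD (Fp L) M₂ T₂) v) hTv₂ (SymplecticGroup.symJ _ _))⁻¹ *
      transportSp (localGram (Fp L) (M₂ + M₂) (gramD (Fp L) M₂ T₂) v) hTv₂ (levi B₂))

set_option maxHeartbeats 1600000 in -- MEASURED: the closing `rfl` (unification with ★ [W4]'s right-hand side) needs ≈ 70 s; 200000 times out
include hPσ hT₁ hT₂ hTv' hTv₁ hTv₂ hW₁ hW₂ in
/-- **(C2c) §1 THE CAYLEY LETTER OF THE FRAME-TRANSPORTED BLOCK IMPLEMENTER**: with `E′ := π(frameMp_{PD} j̃(p₁, p₂)) ∈ Sp(𝕎^𝔻_{T₀})` (`T₀` the tensor Gram matrix),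
`∃ B′, E′ · ι(w_Δ) · E′⁻¹ = (tS J)⁻¹ · tS(m(B′))` — ★ F4a's `hW` shape at the tensor datum; the letter is `B′ = P̂D · (B₁ ⊞_{blkIdx} B₂) · P̂D⁻¹`.
[cite: Kudla1994, §2–§3] [cite: Kudla1984, §1] [cite: MoeglinVignerasWaldspurger1987, Chap. 2 II.1 Rem. (3), (6), II.2] [cite: Weil1964, n° 32, n° 34] -/
theorem exists_proj_frameMp_boxLoc_conj_iotaD_weylDelta :
    ∃ B' : GL (Fin ((M₂ + M₂) + (M₂ + M₂))) (v.adicCompletion (Fp L)),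
      MpPsi.proj _ (frameMp (Fp L) v ((M₂ + M₂) + (M₂ + M₂)) PD (transpose_pd_mul_gramD_mul_pd (Fp L) (M₂ + M₂) P hP hPD)
          (boxLoc (Fp L) v M₂ M₂ (T₁ := T₁) (T₂ := T₂) (p₁, p₂))) *
        iotaD (Fp L) L (IsCMField.complexConj L) (complexConj_imagUnit L) (imagUnit_ne_zero L) (imagUnit_mul_self L) v (M₂ + M₂)
          (gramR_isSymm L e' dV hdV (tensorFrame L dW eW dV') (tensorFrame_real L dW hdW eW dV' hdV'))
          (hermD_eq_map_gramD L e' dV hdV (tensorFrame L dW eW dV') (tensorFrame_real L dW hdW eW dV' hdV'))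
          (weylDelta (Fp L) L (IsCMField.complexConj L) v (M₂ + M₂)
            (T₀ := gramR L e' dV hdV (tensorFrame L dW eW dV') (tensorFrame_real L dW hdW eW dV' hdV'))
            (hermD_eq_map_gramD L e' dV hdV (tensorFrame L dW eW dV') (tensorFrame_real L dW hdW eW dV' hdV'))) *
        (MpPsi.proj _ (frameMp (Fp L) v ((M₂ + M₂) + (M₂ + M₂)) PD (transpose_pd_mul_gramD_mul_pd (Fp L) (M₂ + M₂) P hP hPD)
          (boxLoc (Fp L) v M₂ M₂ (T₁ := T₁) (T₂ := T₂) (p₁, p₂))))⁻¹ =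
      (transportSp (localGram (Fp L) ((M₂ + M₂) + (M₂ + M₂))
          (gramD (Fp L) (M₂ + M₂) (gramR L e' dV hdV (tensorFrame L dW eW dV') (tensorFrame_real L dW hdW eW dV' hdV'))) v) hTv
          (SymplecticGroup.symJ _ _))⁻¹ *
        transportSp (localGram (Fp L) ((M₂ + M₂) + (M₂ + M₂))
          (gramD (Fp L) (M₂ + M₂) (gramR L e' dV hdV (tensorFrame L dW eW dV') (tensorFrame_real L dW hdW eW dV' hdV'))) v) hTv
          (levi B') := by
  -- ★ [W2]: `ι(w_Δ) = frameSp_{PD} (ι′(w_Δ′))` (block datum `T₁ ⊕ᶠ T₂`)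
  have h2 : frameSp (Fp L) v ((M₂ + M₂) + (M₂ + M₂)) PD (transpose_pd_mul_gramD_mul_pd (Fp L) (M₂ + M₂) P hP hPD)
      (iotaD (Fp L) L (IsCMField.complexConj L) (complexConj_imagUnit L) (imagUnit_ne_zero L) (imagUnit_mul_self L) v (M₂ + M₂)
        (UnitaryGroup.isSymm_finSum hT₁ hT₂) rfl
        (weylDelta (Fp L) L (IsCMField.complexConj L) v (M₂ + M₂) (T₀ := UnitaryGroup.finSum M₂ M₂ T₁ T₂) rfl)) =
      iotaD (Fp L) L (IsCMField.complexConj L) (complexConj_imagUnit L) (imagUnit_ne_zero L) (imagUnit_mul_self L) v (M₂ + M₂)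
        (gramR_isSymm L e' dV hdV (tensorFrame L dW eW dV') (tensorFrame_real L dW hdW eW dV' hdV'))
        (hermD_eq_map_gramD L e' dV hdV (tensorFrame L dW eW dV') (tensorFrame_real L dW hdW eW dV' hdV'))
        (weylDelta (Fp L) L (IsCMField.complexConj L) v (M₂ + M₂)
          (T₀ := gramR L e' dV hdV (tensorFrame L dW eW dV') (tensorFrame_real L dW hdW eW dV' hdV'))
          (hermD_eq_map_gramD L e' dV hdV (tensorFrame L dW eW dV') (tensorFrame_real L dW hdW eW dV' hdV'))) :=
    frameSp_iota_weylDelta (Fp L) L (IsCMField.complexConj L) v (M₂ + M₂)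
      (hermD_eq_map_gramD L e' dV hdV (tensorFrame L dW eW dV') (tensorFrame_real L dW hdW eW dV' hdV')) rfl P hP hPD
      (complexConj_imagUnit L) (imagUnit_ne_zero L) (imagUnit_mul_self L)
      (gramR_isSymm L e' dV hdV (tensorFrame L dW eW dV') (tensorFrame_real L dW hdW eW dV' hdV')) (UnitaryGroup.isSymm_finSum hT₁ hT₂)
  -- the block-diagonal letter `B := B₁ ⊞_{blkIdx} B₂`
  have hB : ((UnitaryGroup.reindexGL (blkIdx M₂ M₂) (UnitaryGroup.blockDiagGL (B₁, B₂)) : GL (Fin ((M₂ + M₂) + (M₂ + M₂))) (v.adicCompletion (Fp L))) :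
      Matrix (Fin ((M₂ + M₂) + (M₂ + M₂))) (Fin ((M₂ + M₂) + (M₂ + M₂))) (v.adicCompletion (Fp L))) =
      Matrix.reindex (blkIdx M₂ M₂) (blkIdx M₂ M₂)
        (Matrix.fromBlocks (B₁ : Matrix (Fin (M₂ + M₂)) (Fin (M₂ + M₂)) (v.adicCompletion (Fp L))) 0 0
          (B₂ : Matrix (Fin (M₂ + M₂)) (Fin (M₂ + M₂)) (v.adicCompletion (Fp L)))) := by
    rw [UnitaryGroup.coe_reindexGL, UnitaryGroup.coe_blockDiagGL]
  -- ★ [W3] at the block data, ★ [W4] at the orthogonal doubled frame (the explicit letter `B′ = P̂D · (B₁ ⊞_{blkIdx} B₂) · P̂D⁻¹`)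
  have h3 := spInl_mul_spInr_cayleyLetter (blkIdx M₂ M₂) (localGram (Fp L) (M₂ + M₂) (gramD (Fp L) M₂ T₁) v) (localGram (Fp L) (M₂ + M₂) (gramD (Fp L) M₂ T₂) v)
      (localGram_gramD_finSum (Fp L) v M₂ M₂) hTv₁ hTv₂ hTv' B₁ B₂ _ hB
  have h4 := frameSp_transportSp_symJ_inv_mul_levi (Fp L) v ((M₂ + M₂) + (M₂ + M₂)) PD (transpose_pd_mul_gramD_mul_pd (Fp L) (M₂ + M₂) P hP hPD)
      (pd_mul_transpose_pd (M₂ + M₂) P hPσ hPD) hTv hTv' (UnitaryGroup.reindexGL (blkIdx M₂ M₂) (UnitaryGroup.blockDiagGL (B₁, B₂)))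
  -- `E′ · frameSp(x) · E′⁻¹ = frameSp(π(j̃) · x · π(j̃)⁻¹)` (★ `proj_frameMp`, `proj_boxLoc` are `rfl`)
  have hfold : ∀ x y : LocalSp (Fp L) ((M₂ + M₂) + (M₂ + M₂)) (gramD (Fp L) (M₂ + M₂) (UnitaryGroup.finSum M₂ M₂ T₁ T₂)) v,
      frameSp (Fp L) v ((M₂ + M₂) + (M₂ + M₂)) PD (transpose_pd_mul_gramD_mul_pd (Fp L) (M₂ + M₂) P hP hPD) x *
          frameSp (Fp L) v ((M₂ + M₂) + (M₂ + M₂)) PD (transpose_pd_mul_gramD_mul_pd (Fp L) (M₂ + M₂) P hP hPD) y *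
        (frameSp (Fp L) v ((M₂ + M₂) + (M₂ + M₂)) PD (transpose_pd_mul_gramD_mul_pd (Fp L) (M₂ + M₂) P hP hPD) x)⁻¹ =
      frameSp (Fp L) v ((M₂ + M₂) + (M₂ + M₂)) PD (transpose_pd_mul_gramD_mul_pd (Fp L) (M₂ + M₂) P hP hPD) (x * y * x⁻¹) :=
    fun x y => by rw [map_mul, map_mul, map_inv]
  refine ⟨?_, ?_⟩
  swap
  -- no `rw` on the `LocalMp`∕`LocalSp` letters (★ (C2a): `kabstract`'s `isDefEq` probes time out); `simp only` matches reducibly.  The letter `B′` is NOT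
  -- restated by hand (MEASURED: a hand-written `P̂D · B · P̂D⁻¹` elaborates its `GL` type over `CommSemiring.toSemiring`, ★ [W4]'s over `DivisionSemiring.toSemiring`).
  simp only [proj_frameMp, proj_boxLoc, ← h2, hfold]
  simp only [iotaD_weylDelta_finSum (Fp L) L (IsCMField.complexConj L) (complexConj_imagUnit L) (imagUnit_ne_zero L) (imagUnit_mul_self L) v M₂ M₂
      hT₁ hT₂ rfl rfl rfl hTv' hTv₁ hTv₂, spInl_mul_spInr_conj, hW₁, hW₂]
  refine ((congrArg (frameSp (Fp L) v ((M₂ + M₂) + (M₂ + M₂)) PD (transpose_pd_mul_gramD_mul_pd (Fp L) (M₂ + M₂) P hP hPD)) h3).trans h4).trans ?_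
  -- the witness `B′` is read off ★ [W4]'s right-hand side (MEASURED: this last unification ≈ 70 s — the doubled `LocalSp` letters; `exact` instead of
  -- `refine … ?_; rfl` times out at 1600000 heartbeats)
  rfl

end CayleyLetter

/-! ## §2 `E′ := π(frameMp_{PD} j̃(p₁, p₂))` is a mover -/

/-- **(C2c) §2 `E′_ε ℓ_Δ = ℓ_Y`**: the frame transport of Kudla's block implementer over two movers is a mover of the tensor datum
(★ `map_proj_frameMp_pd_deltaLagrangian` ∘ ★ F6a `map_deltaLagrangian_proj_boxLoc`). [cite: Kudla1994, §3 Thm. 3.1] [cite: HarrisKudlaSweet1996, §1 (1.11)]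
[cite: MoeglinVignerasWaldspurger1987, Chap. 2 II Remarque (3)] -/
theorem map_deltaLagrangian_proj_frameMp_boxLoc {T₁ T₂ : Matrix (Fin M₂) (Fin M₂) (Fp L)} (P : GL (Fin (M₂ + M₂)) (Fp L))
    (hP : ((P : Matrix (Fin (M₂ + M₂)) (Fin (M₂ + M₂)) (Fp L)))ᵀ *
        gramR L e' dV hdV (tensorFrame L dW eW dV') (tensorFrame_real L dW hdW eW dV' hdV') * (P : Matrix _ _ (Fp L)) =
      UnitaryGroup.finSum M₂ M₂ T₁ T₂)
    {PD : GL (Fin ((M₂ + M₂) + (M₂ + M₂))) (Fp L)} (hPD : PD = UnitaryGroup.reindexGL (e₂ (M₂ + M₂)) (UnitaryGroup.blockDiagGL (P, P)))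
    (p₁ : LocalMp (Fp L) (M₂ + M₂) (gramD (Fp L) M₂ T₁) v)
    (hp₁ : (deltaLagrangian (Fp L) v M₂).map (toLin (Fp L) v (MpPsi.proj _ p₁)) = lagrangianY (Fp L) (M₂ + M₂) v)
    (p₂ : LocalMp (Fp L) (M₂ + M₂) (gramD (Fp L) M₂ T₂) v)
    (hp₂ : (deltaLagrangian (Fp L) v M₂).map (toLin (Fp L) v (MpPsi.proj _ p₂)) = lagrangianY (Fp L) (M₂ + M₂) v) :
    (deltaLagrangian (Fp L) v (M₂ + M₂)).map (toLin (Fp L) v (MpPsi.proj _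
        (frameMp (Fp L) v ((M₂ + M₂) + (M₂ + M₂)) PD (transpose_pd_mul_gramD_mul_pd (Fp L) (M₂ + M₂) P hP hPD)
          (boxLoc (Fp L) v M₂ M₂ (T₁ := T₁) (T₂ := T₂) (p₁, p₂))))) =
      lagrangianY (Fp L) ((M₂ + M₂) + (M₂ + M₂)) v :=
  map_proj_frameMp_pd_deltaLagrangian (Fp L) v (M₂ + M₂) P hPD (transpose_pd_mul_gramD_mul_pd (Fp L) (M₂ + M₂) P hP hPD) _
    (map_deltaLagrangian_proj_boxLoc L v M₂ M₂ p₁ p₂ hp₁ hp₂)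

end Summit.HodgeConjecture.HodgeConjecture.Cruxes.HLiu418.K2LiuWitnessImplementerCayley

end
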